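import Summits.QuantumFields.BalabanUV.Beta.MultiscaleCubesGeometry
import Summits.QuantumFields.BalabanUV.Beta.MultiscaleLocalBall

/-!
# Beta / MultiscaleParametrixCubesKSites — THE K-SITES OF A BOX OF THE CUBE FAMILY AND THE GENERIC MARGIN LEMMA: bond ends carrying `∂h_□`,
# `supp Δ_ch_□` and the cells on which `h_□` is non-constant all lie within `r₀ = ((d+2)M + 2dL)·S_j + 1` of the corner; the cell oscillation
# of `h_□` is `≤ dLK₁∕M` on EVERY cell; and a hull containing the torus ball of radius `r₀ + (8d+3)·L^A e^{(log L∕R)(8d+3)}·Λ` about the corner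
# contains the `d_n`-balls of radius `8d+2` about every site of the `r₀`-ball whose scale is `≤ Λ` (MODEL; second file of the Route-C INSTANCE
# W5 of the (w4-d)-flat programme, claim «WRS-PARAMETRIX-FLAT» journal l.25540; unit `b2b-balaban-beta-d4-p2`, GEN 12, MODEL crew)

WHY.  Brick (c) (`MultiscaleRemainderWRS.row_remK_mul_le`) needs, per box, (i) the bump data, (ii) a K-margin: the INTERIOR members of the
local propagator at every row-site of `K(h_□)`, and (iii) `n ≤ Λ` there.  This file locates the row-sites of `K(h_□)` for the cube family
`cubeFam` (gen 9∕10, this lineage) inside the `r₀`-ball round the corner and supplies the cell oscillation and the generic margin step; the hull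
with margin itself (`cubeHullR`, a reviewed definition) and its clauses are the sibling `MultiscaleParametrixCubesMargin`.
CONTENT (kernel, 0 sorry, no definition): `dist_le_of_dh_ne_zero`, `exists_bond_of_lapH_ne_zero`, `dist_le_of_lapH_ne_zero`,
`dist_cellPt_le_of_ne` (under (G1)), **`cubeFam_cell_osc_le`** (`|h_□(cell point) − h_□(cell corner)| ≤ dLK₁∕M` on every cell, under (G1)),
**`eq_one_of_sdist_le_of_ball`** (the generic margin step over `MultiscaleLocalBall.dist_le_of_sdist_le`), `card_Kset_le`.

HONEST FRAMING: discharging `BetaPertH` makes Bałaban's UV stability UNCONDITIONAL — NOT the continuum limit, NOT the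
Clay problem.  HONEST DEPENDENCY (verbatim): «continuum YM on T⁴ ⇐ BetaPertH ∧ nine spine estimates (0/9 proved);
BetaPertH ⇐ (D1) ∧ (D4) ∧ CAP+tail; G-an2-4 gates asym, D1 and NE2/3/4.»  THIS MODULE DISCHARGES NOTHING of `BetaPertH`,
asserts NOTHING printed and cites nothing as a fact (ABSOLUTE RULE): [folklore] torus geometry of the MODEL's cube family; (G1) is DATA.
LOCI (shape only): [B6] = `Balaban1984PropagatorsII` (2.1)–(2.2) p. 224, (2.36)–(2.37) p. 229; [B9] = `Balaban1985BackgroundPropagators`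
p. 408 (Ω₀(□)).  No class change on row D4 (critical-path width 0; D4 DISCHARGE NO DATE); NOT BetaPertH, NOT continuum, NOT Clay,
NOT summit progress.
-/

namespace Summit.QuantumFields.BalabanUV.Beta.MultiscaleParametrixCubesKSites

open Finset Function
open Summit.QuantumFields.BalabanUV.Beta.BoxPoincare (Box)
open Summit.QuantumFields.BalabanUV.Beta.MultiscaleCoerciveTorus
open Summit.QuantumFields.BalabanUV.Beta.MultiscaleDecayBudget
open Summit.QuantumFields.BalabanUV.Beta.MultiscaleDistance
open Summit.QuantumFields.BalabanUV.Beta.MultiscaleLocalBall (dist_le_of_sdist_le)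
open Literature.MathematicalPhysics.QuantumFieldTheory.Balaban1983to89
open Literature.MathematicalPhysics.QuantumFieldTheory.Balaban1983to89.B9Thm37GluePU (bsrc btgt bsrc_apply btgt_apply)
open Literature.MathematicalPhysics.QuantumFieldTheory.Balaban1983to89.B9Thm37GlueTorusCov (tblk torusComb)
open Literature.MathematicalPhysics.QuantumFieldTheory.Balaban1983to89.B9Thm37GlueTorusCovPoinc (tdepth_le)
open Literature.MathematicalPhysics.QuantumFieldTheory.Balaban1983to89.B9Thm37GlueTorusCovCT (abs_sub_base_le)
open B5TorusCover (UT Ctr ctrU)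
open B5Leibniz121 (up dist_up_le)
open Summit.QuantumFields.BalabanUV.Beta.MultiscaleRemainderLeibniz (lapH)
open Summit.QuantumFields.BalabanUV.Beta.MultiscaleParametrixHull
open Summit.QuantumFields.BalabanUV.Beta.MultiscaleCubesFamily
open Summit.QuantumFields.BalabanUV.Beta.MultiscaleParametrixCubes
open Summit.QuantumFields.BalabanUV.Beta.MultiscaleCubesGeometry (dist_cellPt_cellPt_le)
open Summit.QuantumFields.BalabanUV.Beta.MultiscaleParametrixBoxes (one_le_MS)

noncomputable section

variable {d : ℕ} {N : Fin d → ℕ} [∀ i, NeZero (N i)] {J K : Type} [Fintype J] [Fintype K]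
  (S : J → ℕ) (hS : ∀ l, 1 ≤ S l) (hdivS : ∀ l i, S l ∣ N i) (lvl : K → J) (zc : (k : K) → Ctr N (S (lvl k)))
  (M : ℕ) (hM : 1 ≤ M) (hMdiv : ∀ j i, M * S j ∣ N i) (inLayer : (j : J) → Ctr N (M * S j) → Prop)
  (hcover : ∀ x : UT N, ∃ k, ∃ v : Box d (S (lvl k)), cellPt S hS hdivS lvl zc k v = x)

/-! ## §2 The K-sites of a box are within `r₀ = ((d+2)M + 2dL)·S_j + 1` of its corner -/

section KSites

variable [NeZero d] [DecidableEq J]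

omit [Fintype K] [DecidableEq J] in
/-- A bond carrying `∂h_□ ≠ 0` has an end in `supp h_□`, so both ends are within `(d+2)M S_j + 1` of the corner. [folklore] -/
theorem dist_le_of_dh_ne_zero (p : Σ j : J, Ctr N (M * S j)) (b : UT N × Fin d)
    (hb : cubeFam S hS M hM hMdiv inLayer p (btgt b) - cubeFam S hS M hM hMdiv inLayer p (bsrc b) ≠ 0) :
    dist (bsrc b) (ctrU N (M * S p.1) p.2) ≤ (((d + 2) * (M * S p.1) : ℕ) : ℝ) + 1 ∧
      dist (btgt b) (ctrU N (M * S p.1) p.2) ≤ (((d + 2) * (M * S p.1) : ℕ) : ℝ) + 1 := by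
  obtain ⟨y, μ⟩ := b
  rw [bsrc_apply, btgt_apply] at hb ⊢
  have hd1 : dist y (up y μ) ≤ 1 := dist_up_le y μ
  have hne : cubeFam S hS M hM hMdiv inLayer p y ≠ 0 ∨ cubeFam S hS M hM hMdiv inLayer p (up y μ) ≠ 0 := by
    by_contra hc
    push Not at hc
    exact hb (by rw [hc.1, hc.2, sub_zero])
  rcases hne with hy | hy
  · have hy' := cubeFam_supp S hS M hM hMdiv inLayer p y hy
    refine ⟨hy'.trans (by linarith), ?_⟩
    calc dist (up y μ) (ctrU N (M * S p.1) p.2) ≤ dist (up y μ) y + dist y (ctrU N (M * S p.1) p.2) := dist_triangle _ _ _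
      _ ≤ 1 + (((d + 2) * (M * S p.1) : ℕ) : ℝ) := add_le_add (by rw [dist_comm]; exact hd1) hy'
      _ = _ := add_comm _ _
  · have hy' := cubeFam_supp S hS M hM hMdiv inLayer p (up y μ) hy
    refine ⟨?_, hy'.trans (by linarith)⟩
    calc dist y (ctrU N (M * S p.1) p.2) ≤ dist y (up y μ) + dist (up y μ) (ctrU N (M * S p.1) p.2) := dist_triangle _ _ _
      _ ≤ 1 + (((d + 2) * (M * S p.1) : ℕ) : ℝ) := add_le_add hd1 hy'
      _ = _ := add_comm _ _

omit [NeZero d] [Fintype J] [Fintype K] [DecidableEq J] in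
/-- `Δ_ch(x) ≠ 0` ⟹ some bond at `x` carries `∂h ≠ 0`. [folklore] -/
theorem exists_bond_of_lapH_ne_zero (c : UT N × Fin d → ℝ) (h : UT N → ℝ) (x : UT N) (hx : lapH bsrc btgt c h x ≠ 0) :
    ∃ b : UT N × Fin d, (bsrc b = x ∨ btgt b = x) ∧ h (btgt b) - h (bsrc b) ≠ 0 := by
  by_contra hne
  push Not at hne
  apply hx
  unfold lapH
  refine Finset.sum_eq_zero fun b _ => ?_
  by_cases h1 : bsrc b = x
  · rw [hne b (Or.inl h1)]; simp
  · by_cases h2 : btgt b = x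
    · rw [hne b (Or.inr h2)]; simp
    · rw [if_neg h1, if_neg h2, sub_zero]

omit [Fintype K] [DecidableEq J] in
/-- A site with `Δ_ch_□ ≠ 0` is within `(d+2)M S_j + 1` of the corner. [folklore] -/
theorem dist_le_of_lapH_ne_zero (c : UT N × Fin d → ℝ) (p : Σ j : J, Ctr N (M * S j)) (x : UT N)
    (hx : lapH bsrc btgt c (cubeFam S hS M hM hMdiv inLayer p) x ≠ 0) :
    dist x (ctrU N (M * S p.1) p.2) ≤ (((d + 2) * (M * S p.1) : ℕ) : ℝ) + 1 := by
  obtain ⟨b, hbx, hb⟩ := exists_bond_of_lapH_ne_zero c _ x hx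
  have h := dist_le_of_dh_ne_zero S hS M hM hMdiv inLayer p b hb
  rcases hbx with hbx | hbx
  · rw [← hbx]; exact h.1
  · rw [← hbx]; exact h.2

omit [Fintype K] [DecidableEq J] in
/-- **Cells on which `h_□` is non-constant are within `(d+2)M S_j + 2d(L S_j − 1)` of the corner** — under (G1) «`h_□` vanishes on the cells
of the levels not adjacent to `j`» such a cell is adjacent (`S_{l_k} ≤ L·S_j`) and has diameter `≤ 2d(S_{l_k} − 1)`. [folklore] -/
theorem dist_cellPt_le_of_ne {L : ℕ}
    (hfar : ∀ (p : Σ j : J, Ctr N (M * S j)) k, ¬ (S p.1 ≤ L * S (lvl k) ∧ S (lvl k) ≤ L * S p.1) →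
      ∀ v, cubeFam S hS M hM hMdiv inLayer p (cellPt S hS hdivS lvl zc k v) = 0)
    (p : Σ j : J, Ctr N (M * S j)) (k : K) (v v' : Box d (S (lvl k)))
    (hne : cubeFam S hS M hM hMdiv inLayer p (cellPt S hS hdivS lvl zc k v) ≠ cubeFam S hS M hM hMdiv inLayer p (cellPt S hS hdivS lvl zc k v'))
    (w : Box d (S (lvl k))) :
    dist (cellPt S hS hdivS lvl zc k w) (ctrU N (M * S p.1) p.2) ≤ (((d + 2) * (M * S p.1) : ℕ) : ℝ) + 2 * d * (L * S p.1) ∧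
      S (lvl k) ≤ L * S p.1 := by
  have hadj : S p.1 ≤ L * S (lvl k) ∧ S (lvl k) ≤ L * S p.1 := by
    by_contra hna
    exact hne (by rw [hfar p k hna v, hfar p k hna v'])
  -- one of the two points is in the support
  have hsome : ∃ u : Box d (S (lvl k)), cubeFam S hS M hM hMdiv inLayer p (cellPt S hS hdivS lvl zc k u) ≠ 0 := by
    by_contra hc
    push Not at hc
    exact hne (by rw [hc v, hc v'])
  obtain ⟨u, hu⟩ := hsome
  have hu' := cubeFam_supp S hS M hM hMdiv inLayer p _ hu
  have hdiam := dist_cellPt_cellPt_le S hS hdivS lvl zc k w u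
  have hcast : 2 * ((d * (S (lvl k) - 1) : ℕ) : ℝ) ≤ 2 * d * (L * S p.1) := by
    have h1 : d * (S (lvl k) - 1) ≤ d * (L * S p.1) := Nat.mul_le_mul_left d ((Nat.sub_le _ _).trans hadj.2)
    have h2 : ((d * (S (lvl k) - 1) : ℕ) : ℝ) ≤ ((d * (L * S p.1) : ℕ) : ℝ) := by exact_mod_cast h1
    have h3 : ((d * (L * S p.1) : ℕ) : ℝ) = (d : ℝ) * (L * S p.1) := by push_cast; ring
    linarith
  refine ⟨?_, hadj.2⟩
  calc dist (cellPt S hS hdivS lvl zc k w) (ctrU N (M * S p.1) p.2)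
      ≤ dist (cellPt S hS hdivS lvl zc k w) (cellPt S hS hdivS lvl zc k u) + dist (cellPt S hS hdivS lvl zc k u) (ctrU N (M * S p.1) p.2) :=
        dist_triangle _ _ _
    _ ≤ 2 * d * (L * S p.1) + (((d + 2) * (M * S p.1) : ℕ) : ℝ) := add_le_add (hdiam.trans hcast) hu'
    _ = _ := add_comm _ _

omit [Fintype K] in
/-- **The cell oscillation of a cube bump, for EVERY cell**: `|h_□(cell point) − h_□(cell corner)| ≤ d·L·K₁∕M` — on adjacent cells by the comb
path to the corner (`|∂h_□| ≤ K₁∕(M S_j)`, depth `≤ d(S_{l_k} − 1)`, `S_{l_k} ≤ L S_j`), on the other cells both values vanish by (G1).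
[cite: Balaban1984PropagatorsII, (2.36) p.229 + (2.40) p.230] [folklore] -/
theorem cubeFam_cell_osc_le (h2N : ∀ j i, 2 * (M * S j) ≤ N i) (hcov : ∀ x, ∃ j, inLayer j (tblk (one_le_MS S hS hM j) (hMdiv j) x)) {L : ℕ}
    (hcmp : ∀ (p q : Σ j : J, Ctr N (M * S j)) (x y : UT N), dist x y ≤ 2 →
      rawFam S hS M hM hMdiv inLayer p x ≠ 0 → rawFam S hS M hM hMdiv inLayer q y ≠ 0 → S p.1 ≤ L * S q.1) {nadj : ℕ}
    (hlay : ∀ x, (univ.filter fun j : J => ∃ z : Ctr N (M * S j), rawFam S hS M hM hMdiv inLayer ⟨j, z⟩ x ≠ 0).card ≤ nadj)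
    (hfar : ∀ (p : Σ j : J, Ctr N (M * S j)) k, ¬ (S p.1 ≤ L * S (lvl k) ∧ S (lvl k) ≤ L * S p.1) →
      ∀ v, cubeFam S hS M hM hMdiv inLayer p (cellPt S hS hdivS lvl zc k v) = 0)
    (p : Σ j : J, Ctr N (M * S j)) (k : K) (v : Box d (S (lvl k))) :
    |cubeFam S hS M hM hMdiv inLayer p (cellPt S hS hdivS lvl zc k v) - cubeFam S hS M hM hMdiv inLayer p (ctrU N (S (lvl k)) (zc k))| ≤
      d * L * K1 d L nadj / M := by
  have hK0 : 0 ≤ K1 d L nadj := K1_nonneg d L nadj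
  have hM0 : (0 : ℝ) < M := by exact_mod_cast hM
  by_cases hadj : S p.1 ≤ L * S (lvl k) ∧ S (lvl k) ≤ L * S p.1
  · have hθ := cubeFam_bond_le S hS M hM hMdiv inLayer h2N hcov hcmp hlay p
    have hpath := abs_sub_base_le (torusComb (hS (lvl k)) (hdivS (lvl k))) (cubeFam S hS M hM hMdiv inLayer p) hθ
      (cellPt S hS hdivS lvl zc k v)
    have hbase : (torusComb (N := N) (hS (lvl k)) (hdivS (lvl k))).base
        ((torusComb (N := N) (hS (lvl k)) (hdivS (lvl k))).blk (cellPt S hS hdivS lvl zc k v)) = ctrU N (S (lvl k)) (zc k) := by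
      show ctrU N (S (lvl k)) (tblk (hS (lvl k)) (hdivS (lvl k)) (cellPt S hS hdivS lvl zc k v)) = _
      rw [cellPt, tblk_cubePt]
    rw [hbase] at hpath
    have hdep : ((torusComb (N := N) (hS (lvl k)) (hdivS (lvl k))).depth (cellPt S hS hdivS lvl zc k v) : ℝ) ≤ (d : ℝ) * (L * S p.1) := by
      have h1 := tdepth_le (N := N) (hS (lvl k)) (cellPt S hS hdivS lvl zc k v)
      have h2 : d * (S (lvl k) - 1) ≤ d * (L * S p.1) := Nat.mul_le_mul_left d ((Nat.sub_le _ _).trans hadj.2)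
      exact_mod_cast h1.trans h2
    have hSj : (0 : ℝ) < S p.1 := by exact_mod_cast hS p.1
    have hθ0 : 0 ≤ K1 d L nadj / ((M : ℝ) * S p.1) := by positivity
    calc |cubeFam S hS M hM hMdiv inLayer p (cellPt S hS hdivS lvl zc k v) - cubeFam S hS M hM hMdiv inLayer p (ctrU N (S (lvl k)) (zc k))|
        ≤ ((torusComb (N := N) (hS (lvl k)) (hdivS (lvl k))).depth (cellPt S hS hdivS lvl zc k v) : ℝ) * (K1 d L nadj / ((M : ℝ) * S p.1)) :=
          hpath
      _ ≤ (d : ℝ) * (L * S p.1) * (K1 d L nadj / ((M : ℝ) * S p.1)) := mul_le_mul_of_nonneg_right hdep hθ0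
      _ = d * L * K1 d L nadj / M := by field_simp
  · have hcorner : ctrU N (S (lvl k)) (zc k) = cellPt S hS hdivS lvl zc k (fun _ => ⟨0, hS (lvl k)⟩) := by
      rw [cellPt, cubePt_zero]
    rw [hfar p k hadj v, hcorner, hfar p k hadj _, sub_zero, abs_zero]
    positivity

end KSites


/-! ## §3 The generic margin step -/

section Generic

variable [NeZero d] {L : ℕ} (hL : 1 ≤ L) (e : J → ℕ) (hSe : ∀ l, S l = L ^ e l) {R : ℝ} (hR : 0 < R) {A : ℕ}
  (hadd : ∀ x y : UT N, |(e (lvl (cellOf S hS hdivS lvl zc hcover x)) : ℝ) - e (lvl (cellOf S hS hdivS lvl zc hcover y))| ≤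
    A + sdist bsrc btgt (siteScale S hS hdivS lvl zc hcover) x y / R)

include hL hSe hR hadd

omit [Fintype J] [Fintype K] [NeZero d] in
/-- **THE GENERIC MARGIN STEP**: graded sides with the additive datum; a {0,1}-function `χ` equal to `1` on the torus ball of radius `ρ₁` about
`c`; a site `x` with `dist(x,c) ≤ r₀` and scale `n(x) ≤ Λ`; and `r₀ + (8d+3)·(L^A e^{(log L∕R)(8d+3)})·Λ ≤ ρ₁`.  Then the `d_n`-ball of radius
`8d+2` about `x` lies in `{χ = 1}` (`MultiscaleLocalBall.dist_le_of_sdist_le` + the triangle inequality). [cite: Balaban1985BackgroundPropagators, p.408 (Ω₀(□))] [folklore] -/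
theorem eq_one_of_sdist_le_of_ball (χ : UT N → ℝ) (c : UT N) {ρ₁ r₀ Λs : ℝ} (hχball : ∀ y, dist y c ≤ ρ₁ → χ y = 1)
    (hmargin : r₀ + (8 * d + 3) * ((L : ℝ) ^ A * Real.exp (Real.log L / R * (8 * d + 3))) * Λs ≤ ρ₁)
    (x : UT N) (hx : dist x c ≤ r₀) (hnx : (siteScale S hS hdivS lvl zc hcover x : ℝ) ≤ Λs)
    (q : UT N) (hq : sdist bsrc btgt (siteScale S hS hdivS lvl zc hcover) q x ≤ 8 * d + 2) : χ q = 1 := by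
  set Γ : ℝ := (L : ℝ) ^ A * Real.exp (Real.log L / R * (8 * d + 3)) with hΓ
  have hΓ0 : 0 ≤ Γ := by positivity
  have hgr : ∀ y, siteScale S hS hdivS lvl zc hcover y = L ^ (e (lvl (cellOf S hS hdivS lvl zc hcover y))) := fun y => by
    rw [siteScale, hSe]
  have hqx := dist_le_of_sdist_le (siteScale S hS hdivS lvl zc hcover) (one_le_siteScale S hS hdivS lvl zc hcover) hL
    (fun y => e (lvl (cellOf S hS hdivS lvl zc hcover y))) hgr hR (A := A) hadd hq
  have h83 : (8 * (d : ℝ) + 2 + 1) = 8 * d + 3 := by ring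
  rw [h83, ← hΓ] at hqx
  have hqx' : dist q x ≤ (8 * d + 3) * Γ * Λs := by
    calc dist q x ≤ (8 * d + 3) * (Γ * (siteScale S hS hdivS lvl zc hcover x : ℝ)) := hqx
      _ ≤ (8 * d + 3) * (Γ * Λs) := by gcongr
      _ = _ := by ring
  refine hχball q ?_
  have htri := dist_triangle q x c
  linarith

end Generic

omit [∀ i, NeZero (N i)] [Fintype J] [Fintype K] in
/-- **K-sets lie in the hulls, so their overlap is counted by the hull count**: for {0,1}-valued hulls and a family of predicates implying
`χ_□(x) = 1`, `#{□ : K_□(x)} ≤ Σ_□ χ_□(x)`. [folklore] -/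
theorem card_Kset_le {ι : Type} [Fintype ι] (χ : ι → UT N → ℝ) (hχ : ∀ z x, χ z x = 0 ∨ χ z x = 1) (Kset : ι → UT N → Prop)
    [∀ z, DecidablePred (Kset z)] (hK : ∀ z x, Kset z x → χ z x = 1) (x : UT N) :
    ((univ.filter fun z => Kset z x).card : ℝ) ≤ ∑ z, χ z x := by
  classical
  calc ((univ.filter fun z => Kset z x).card : ℝ) = ∑ z ∈ univ.filter (fun z => Kset z x), (1 : ℝ) := by simp
    _ = ∑ z ∈ univ.filter (fun z => Kset z x), χ z x :=
        Finset.sum_congr rfl fun z hz => (hK z x (mem_filter.mp hz).2).symm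
    _ ≤ ∑ z, χ z x :=
        Finset.sum_le_sum_of_subset_of_nonneg (Finset.filter_subset _ _) fun z _ _ => by
          rcases hχ z x with h | h <;> simp [h]

end

end Summit.QuantumFields.BalabanUV.Beta.MultiscaleParametrixCubesKSites
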